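import Mathlib
import Summits.KontsevichZagierPeriods.KontsevichZagierPeriods.Theses.SymplecticScissors
import Literature.NumberTheory.Transcendental.KZCalculusProofs
import Literature.NumberTheory.Transcendental.SemialgebraicMapsProofs

/-!
# `VolumeForm` (stmt-KontsevichZagierPeriods-3814), line `Sketch` — stub `stub_coneThird`

The **Democritus–Archimedes cone map** as ONE change-of-variables generator
(`KZ.changeOfVariablesRel`, rule (2) of [Kontsevich–Zagier 2001, §1.2]): the rational map
`Φ (x, y, z) = (x / z, y / z, z³ / 3)` carries the open cone `{x² + y² < z², 0 < z < 1}`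
(volume `π / 3`, integrand `1`, the SOURCE `r`) onto the solid cylinder
`{u² + v² < 1} × (0, 1/3)` (integrand `1`, the TARGET `r'`): "cone = cylinder / 3".

The witness, checked against the five fields of `changeOfVariablesRel`:
* `Φ` is `ℚ`-semialgebraic on the cone (coordinates `X₀ / X₂`, `X₁ / X₂` with `X₂ ≠ 0` on the
  cone, and `X₂³ / 3`: `isSemialgebraicFunOn_aeval_div_aeval` + `IsSemialgebraicMapOn.of_forall`);
* `Φ` is differentiable at every point with `z ≠ 0`, with upper-triangular derivative
  `Φ' = [[1/z, 0, -x/z²], [0, 1/z, -y/z²], [0, 0, z²]]`, so `det Φ' = z⁻¹ · z⁻¹ · z² = 1`;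
* `Φ` is injective on `{z > 0}` (`t ↦ t³` is injective on `[0, ∞)`, then clear denominators);
* `Φ '' cone = cylinder`: `(x/z)² + (y/z)² = (x² + y²)/z² < 1` and `0 < z³/3 < 1/3`; conversely
  `(u z, v z, z)` with `z = (3 s)^{1/3} ∈ (0, 1)` lies in the cone and maps to `(u, v, s)`;
* `1 = 1 · |1|` on the cone.

Sources: M. Kontsevich, D. Zagier, *Periods* (2001), §1.2 rule (2); Archimedes, *Method*
(Democritus' cone theorem); everything else is calculus bookkeeping (folklore).
-/

noncomputable section

open Set MeasureTheory MvPolynomial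
open Literature.NumberTheory.Transcendental

namespace Summit.KontsevichZagierPeriods.SymplecticScissors.VolumeForm

/-- Quantifying over `Fin 3`, with literal indices. [folklore] -/
theorem coneThird_forall_fin_three {P : Fin 3 → Prop} : (∀ j, P j) ↔ P 0 ∧ P 1 ∧ P 2 :=
  ⟨fun h => ⟨h 0, h 1, h 2⟩, fun h j => by
    fin_cases j
    · exact h.1
    · exact h.2.1
    · exact h.2.2⟩

/-- The derivative of a perspective coordinate `p ↦ p i / p 2` of the cone map at a point with
`p 2 ≠ 0` is `v ↦ (p 2)⁻¹ v i - (p i / p 2 ^ 2) v 2`. [folklore] -/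
theorem coneThird_hasFDerivAt_div (i : Fin 3) (x : Fin 3 → ℝ) (hx : x 2 ≠ 0) :
    HasFDerivAt (fun p : Fin 3 → ℝ => p i / p 2)
      ((x 2)⁻¹ • ContinuousLinearMap.proj (R := ℝ) (φ := fun _ : Fin 3 => ℝ) i -
        (x i / x 2 ^ 2) • ContinuousLinearMap.proj (R := ℝ) (φ := fun _ : Fin 3 => ℝ) 2) x := by
  have hi : HasFDerivAt (fun p : Fin 3 → ℝ => p i)
      (ContinuousLinearMap.proj (R := ℝ) (φ := fun _ : Fin 3 => ℝ) i) x := hasFDerivAt_apply i x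
  have h2 : HasFDerivAt (fun p : Fin 3 → ℝ => p 2)
      (ContinuousLinearMap.proj (R := ℝ) (φ := fun _ : Fin 3 => ℝ) 2) x := hasFDerivAt_apply 2 x
  have hinv : HasFDerivAt (fun p : Fin 3 → ℝ => (p 2)⁻¹)
      ((-(x 2 ^ 2)⁻¹) • ContinuousLinearMap.proj (R := ℝ) (φ := fun _ : Fin 3 => ℝ) 2) x :=
    (hasDerivAt_inv hx).comp_hasFDerivAt x h2
  have hmul := hi.mul hinv
  have hfun : (fun p : Fin 3 → ℝ => p i / p 2) =
      (fun p : Fin 3 → ℝ => p i) * fun p : Fin 3 → ℝ => (p 2)⁻¹ := by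
    funext p
    simp [div_eq_mul_inv]
  rw [hfun]
  refine hmul.congr_fderiv ?_
  ext v
  simp only [_root_.add_apply, _root_.smul_apply, _root_.sub_apply,
    ContinuousLinearMap.proj_apply, smul_eq_mul]
  field_simp
  ring

/-- The derivative of the third coordinate `p ↦ p 2 ^ 3 / 3` of the cone map is
`v ↦ p 2 ^ 2 · v 2`. [folklore] -/
theorem coneThird_hasFDerivAt_cube (x : Fin 3 → ℝ) :
    HasFDerivAt (fun p : Fin 3 → ℝ => p 2 ^ 3 / 3)
      ((x 2 ^ 2) • ContinuousLinearMap.proj (R := ℝ) (φ := fun _ : Fin 3 => ℝ) 2) x := by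
  have h2 : HasFDerivAt (fun p : Fin 3 → ℝ => p 2)
      (ContinuousLinearMap.proj (R := ℝ) (φ := fun _ : Fin 3 => ℝ) 2) x := hasFDerivAt_apply 2 x
  have h := ((hasDerivAt_pow 3 (x 2)).div_const 3).comp_hasFDerivAt x h2
  refine h.congr_fderiv ?_
  ext v
  simp only [_root_.smul_apply, ContinuousLinearMap.proj_apply, smul_eq_mul]
  push_cast
  ring

/-- **Democritus–Archimedes cone map** (stub `stub_coneThird` of `VolumeForm`,
stmt-KontsevichZagierPeriods-3814, line `Sketch`). For representations `r` on the open cone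
`{p 0 ^ 2 + p 1 ^ 2 < p 2 ^ 2, 0 < p 2 < 1}` and `r'` on the cylinder
`{q 0 ^ 2 + q 1 ^ 2 < 1, 0 < q 2 < 1 / 3}`, both with integrand `1` on their domains, `[r] − [r']` is
one change-of-variables generator of the Kontsevich–Zagier calculus, with witness
`Φ p = (p 0 / p 2, p 1 / p 2, p 2 ^ 3 / 3)` and
`Φ' p = [[1/p 2, 0, -p 0/p 2 ²], [0, 1/p 2, -p 1/p 2 ²], [0, 0, p 2 ²]]` (`det = 1`): "a cone is a third
of its cylinder". [cite: KontsevichZagier2001, §1.2 rule (2)] -/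
theorem stub_coneThird : ∀ (r r' : KZ.IntegralRep 3),
    r.domain = {p | p 0 ^ 2 + p 1 ^ 2 < p 2 ^ 2 ∧ 0 < p 2 ∧ p 2 < 1} →
    r'.domain = {q | q 0 ^ 2 + q 1 ^ 2 < 1 ∧ 0 < q 2 ∧ q 2 < 1 / 3} →
    (∀ p ∈ r.domain, r.integrand p = 1) → (∀ q ∈ r'.domain, r'.integrand q = 1) →
    KZ.of r - KZ.of r' ∈ KZ.changeOfVariablesRel := by
  intro r r' hr hr' hf hf'
  -- membership in the two domains, unfolded
  have memr : ∀ p, p ∈ r.domain ↔ (p 0 ^ 2 + p 1 ^ 2 < p 2 ^ 2 ∧ 0 < p 2 ∧ p 2 < 1) :=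
    fun p => by rw [hr]; rfl
  have memr' : ∀ q, q ∈ r'.domain ↔ (q 0 ^ 2 + q 1 ^ 2 < 1 ∧ 0 < q 2 ∧ q 2 < 1 / 3) :=
    fun q => by rw [hr']; rfl
  -- the witness
  let Φ : (Fin 3 → ℝ) → (Fin 3 → ℝ) := fun p => ![p 0 / p 2, p 1 / p 2, p 2 ^ 3 / 3]
  let Φ' : (Fin 3 → ℝ) → (Fin 3 → ℝ) →L[ℝ] (Fin 3 → ℝ) := fun x =>
    ContinuousLinearMap.pi
      ![(x 2)⁻¹ • ContinuousLinearMap.proj (R := ℝ) (φ := fun _ : Fin 3 => ℝ) 0 -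
          (x 0 / x 2 ^ 2) • ContinuousLinearMap.proj (R := ℝ) (φ := fun _ : Fin 3 => ℝ) 2,
        (x 2)⁻¹ • ContinuousLinearMap.proj (R := ℝ) (φ := fun _ : Fin 3 => ℝ) 1 -
          (x 1 / x 2 ^ 2) • ContinuousLinearMap.proj (R := ℝ) (φ := fun _ : Fin 3 => ℝ) 2,
        (x 2 ^ 2) • ContinuousLinearMap.proj (R := ℝ) (φ := fun _ : Fin 3 => ℝ) 2]
  have hΦ0 : ∀ p, Φ p 0 = p 0 / p 2 := fun p => rfl
  have hΦ1 : ∀ p, Φ p 1 = p 1 / p 2 := fun p => rfl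
  have hΦ2 : ∀ p, Φ p 2 = p 2 ^ 3 / 3 := fun p => rfl
  -- the Jacobian determinant (upper triangular, `z⁻¹ · z⁻¹ · z² = 1`)
  have hdet : ∀ x : Fin 3 → ℝ, x 2 ≠ 0 → (Φ' x).det = 1 := by
    intro x hx2
    have key : (x 2)⁻¹ * (x 2)⁻¹ * x 2 ^ 2 = 1 := by
      rw [← mul_inv, ← sq, inv_mul_cancel₀ (pow_ne_zero 2 hx2)]
    simp only [ContinuousLinearMap.det]
    rw [← LinearMap.det_toMatrix', Matrix.det_fin_three]
    simpa [Φ', LinearMap.toMatrix'_apply] using key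
  -- Φ maps the cone into the cylinder
  have hmaps : ∀ p ∈ r.domain, Φ p ∈ r'.domain := by
    intro p hp
    obtain ⟨hpr, hp2, hp21⟩ := (memr p).1 hp
    rw [memr', hΦ0, hΦ1, hΦ2]
    refine ⟨?_, by positivity, ?_⟩
    · rw [div_pow, div_pow, ← add_div, div_lt_one (by positivity)]
      exact hpr
    · have h3 : p 2 ^ 3 < 1 := pow_lt_one₀ hp2.le hp21 three_ne_zero
      linarith
  -- Φ is onto the cylinder: explicit inverse `(u z, v z, z)`, `z = (3 s) ^ (1/3)`
  have hsurj : ∀ q ∈ r'.domain, ∃ p ∈ r.domain, Φ p = q := by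
    intro q hq
    obtain ⟨hqr, hq2, hq23⟩ := (memr' q).1 hq
    set z : ℝ := (3 * q 2) ^ ((3 : ℕ) : ℝ)⁻¹ with hz_def
    have hz : 0 < z := Real.rpow_pos_of_pos (by positivity) _
    have hz3 : z ^ 3 = 3 * q 2 := Real.rpow_inv_natCast_pow (by positivity) three_ne_zero
    have hz1 : z < 1 :=
      lt_of_pow_lt_pow_left₀ 3 zero_le_one (by rw [hz3, one_pow]; linarith)
    refine ⟨![q 0 * z, q 1 * z, z], ?_, ?_⟩
    · rw [memr]
      show (q 0 * z) ^ 2 + (q 1 * z) ^ 2 < z ^ 2 ∧ 0 < z ∧ z < 1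
      refine ⟨?_, hz, hz1⟩
      calc (q 0 * z) ^ 2 + (q 1 * z) ^ 2 = (q 0 ^ 2 + q 1 ^ 2) * z ^ 2 := by ring
        _ < 1 * z ^ 2 := mul_lt_mul_of_pos_right hqr (by positivity)
        _ = z ^ 2 := one_mul _
    · refine funext (coneThird_forall_fin_three.2 ⟨?_, ?_, ?_⟩)
      · show q 0 * z / z = q 0
        exact mul_div_cancel_right₀ (q 0) hz.ne'
      · show q 1 * z / z = q 1
        exact mul_div_cancel_right₀ (q 1) hz.ne'
      · show z ^ 3 / 3 = q 2
        rw [hz3]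
        ring
  refine ⟨3, r, r', Φ, Φ', ?_, ?_, ?_, ?_, ?_, rfl⟩
  · -- `Φ` is `ℚ`-semialgebraic on the cone
    have hq : ∀ p ∈ r.domain, aeval p (X 2 : MvPolynomial (Fin 3) ℚ) ≠ (0 : ℝ) := by
      intro p hp
      obtain ⟨-, hp2, -⟩ := (memr p).1 hp
      rw [aeval_X]
      exact hp2.ne'
    have hq3 : ∀ p ∈ r.domain, aeval p (3 : MvPolynomial (Fin 3) ℚ) ≠ (0 : ℝ) := by
      intro p _
      simp
    refine IsSemialgebraicMapOn.of_forall r.isSemialgebraic_domain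
      (coneThird_forall_fin_three.2 ⟨?_, ?_, ?_⟩)
    · refine (isSemialgebraicFunOn_aeval_div_aeval r.isSemialgebraic_domain (X 0) (X 2) hq).congr ?_
      intro p _
      simp [hΦ0]
    · refine (isSemialgebraicFunOn_aeval_div_aeval r.isSemialgebraic_domain (X 1) (X 2) hq).congr ?_
      intro p _
      simp [hΦ1]
    · refine (isSemialgebraicFunOn_aeval_div_aeval r.isSemialgebraic_domain (X 2 ^ 3) 3 hq3).congr ?_
      intro p _
      simp [hΦ2]
  · -- differentiability within the cone
    intro x hx
    obtain ⟨-, hx2, -⟩ := (memr x).1 hx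
    refine HasFDerivAt.hasFDerivWithinAt
      (hasFDerivAt_pi'' (coneThird_forall_fin_three.2 ⟨?_, ?_, ?_⟩))
    · rw [ContinuousLinearMap.proj_pi]
      exact coneThird_hasFDerivAt_div 0 x hx2.ne'
    · rw [ContinuousLinearMap.proj_pi]
      exact coneThird_hasFDerivAt_div 1 x hx2.ne'
    · rw [ContinuousLinearMap.proj_pi]
      exact coneThird_hasFDerivAt_cube x
  · -- injectivity on the cone
    intro p hp q hq hpq
    obtain ⟨-, hp2, -⟩ := (memr p).1 hp
    obtain ⟨-, hq2, -⟩ := (memr q).1 hq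
    have e0 : p 0 / p 2 = q 0 / q 2 := by rw [← hΦ0, ← hΦ0, hpq]
    have e1 : p 1 / p 2 = q 1 / q 2 := by rw [← hΦ1, ← hΦ1, hpq]
    have e2 : p 2 ^ 3 / 3 = q 2 ^ 3 / 3 := by rw [← hΦ2, ← hΦ2, hpq]
    have h2 : p 2 = q 2 := by
      have h : p 2 ^ 3 = q 2 ^ 3 := by linarith
      exact (pow_left_inj₀ hp2.le hq2.le three_ne_zero).1 h
    rw [← h2] at e0 e1
    have h0 : p 0 = q 0 := (div_left_inj' hp2.ne').1 e0
    have h1 : p 1 = q 1 := (div_left_inj' hp2.ne').1 e1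
    exact funext (coneThird_forall_fin_three.2 ⟨h0, h1, h2⟩)
  · -- the image is the cylinder
    refine Subset.antisymm (fun q hq => ?_) ?_
    · obtain ⟨p, hp, hpq⟩ := hsurj q hq
      exact ⟨p, hp, hpq⟩
    · rintro _ ⟨p, hp, rfl⟩
      exact hmaps p hp
  · -- the integrands: `1 = 1 · |1|`
    intro x hx
    obtain ⟨-, hx2, -⟩ := (memr x).1 hx
    rw [hf x hx, hf' _ (hmaps x hx), hdet x hx2.ne']
    norm_num

end Summit.KontsevichZagierPeriods.SymplecticScissors.VolumeForm

end
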